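import Literature.Analysis.Distribution.EllipticPointSolvability
import Literature.NumberTheory.Automorphic.AutomorphicFormsStableFolland
import HarnessLib

/-!
# Automorphic forms are reproduced by a smooth compactly supported kernel in exponential
# coordinates: `φ(g) = ∫ α(t) φ(g exp(∑ tᵢ Bᵢ)) dt`, unconditionally

Topic `NumberTheory/Automorphic`; sequel of `AutomorphicFormsGrowthFolland` (which derived this
identity inside the proof of `HasModerateGrowth.lieDeriv_basisLie_of_folland`, granted the two
named facts `Folland1995_thm845` and `Folland1995_cor634` of elliptic regularity) and of
`Literature/Analysis/Distribution/EllipticPointSolvability` (the reproducing kernel of the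
solutions of an elliptic equation, now a theorem: `exists_kernel_of_isEllipticOn_of_lt`, for
operators of order `> dim/2`). For a regular automorphy datum `𝒟` over a finite-dimensional
coefficient algebra with `ℝ`-linear involution and an automorphic form `φ` we PROVE:

* `annihilator_shift` — the elliptic annihilator `∑_{j ≤ M} rⱼ L_B^j φ = 0` (`L_B = ∑ᵢ Bᵢ Bᵢ`,
  `r_M = 1`; `IsAutomorphicForm.exists_annihilator`) may be multiplied by any power `L_B^s`
  (linearity of `L_B` on archimedean-smooth functions), so its order can be raised at will;
* `IsAutomorphicForm.exists_reproducing_chartExp` — **there is a basis `B` of `𝔤` such that for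
  every `ρ > 0` some `α ∈ C_c^∞(ℝ^d)` supported in the ball of radius `ρ` satisfies
  `φ(g) = ∫ α(t) φ(g · ι(exp ∑ tᵢ Bᵢ)) dt` for ALL `g ∈ G(𝔸)`** — Harish-Chandra's convolution
  identity `φ = φ ∗ α` (Harish-Chandra 1966, §8, Thm. 1; Borel 1972, Thm. 3.18; Borel 1997,
  Thm. 2.14) in exponential coordinates of the first kind: the chart functions of all translates of
  `φ` solve the transported elliptic equation near `0` (`smoothDiffOp_chartFun_eq_zero`,
  `isEllipticOn_pairPresentation` of `AutomorphicFormsGrowthFolland`, `exists_chartFields` of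
  `ArchimedeanExpChart`), whose solutions are reproduced by `exists_kernel_of_isEllipticOn_of_lt`.

The passage to a Haar-measure statement on `G_∞` (the named fact
`AutomorphicRepsGL.exists_convolution_eq_self` for `GL_n`) is the sequel. Everything here is
proved; no definitions, no named facts.

## References

* Harish-Chandra, *Discrete series for semisimple Lie groups. II*, Acta Math. 116 (1966), §8,
  Thm. 1 [HarishChandra1966].
* A. Borel, *Représentations de groupes localement compacts*, LNM 276 (1972), 3.15–3.18
  [Borel1972].
* A. Borel, *Automorphic forms on `SL₂(ℝ)`* (1997), Thm. 2.14 [Borel1997].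
* G. B. Folland, *Introduction to Partial Differential Equations*, 2nd ed. (1995), Thm. (8.45),
  Cor. (6.34) [Folland2020].
-/

noncomputable section

open scoped MatrixGroups Matrix ContDiff Topology
open Filter Set MeasureTheory Literature.Analysis.Distribution

namespace Literature.NumberTheory.Automorphic

-- Mathlib idiom (Mathlib/Algebra/Lie/OfAssociative.lean); needed to mention Lie subalgebras of matrix algebras
attribute [local instance 100] LieRing.ofAssociativeRing

variable {K : Type} [Field K] [NumberField K]
  {A : Type*} [NormedCommRing A] [NormedAlgebra ℝ A] [NormedAlgebra ℚ A] [CompleteSpace A]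
  [StarRing A] {N : Type*} [Fintype N] [DecidableEq N]
  {𝒢 : AdelicGroupData K} {𝒟 : AutomorphyDatum 𝒢 A N}

/-! ### Raising the order of the annihilator -/

section Shift

variable [FiniteDimensional ℝ A] {d : ℕ}

/-- **The annihilator may be multiplied by powers of `L_B`.** If `φ` is archimedean-smooth and
`∑_{j ≤ M} rⱼ L^j φ = 0` for `L ψ = ∑ᵢ Bᵢ (Bᵢ ψ)`, then for every `s`,
`∑_{j ≤ M + s} r'ⱼ L^j φ = 0` with `r'ⱼ = r_{j - s}` (`= 0` for `j < s`), i.e.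
`L^s (∑ⱼ rⱼ L^j φ) = 0`: `L` is linear on smooth functions
(`iterLieDeriv_add_of_isArchSmooth_lieDeriv`, `lieDeriv_smul`) and preserves smoothness
(`isArchSmooth_lieDeriv_holds`). [folklore] -/
theorem annihilator_shift (B : Module.Basis (Fin d) ℝ 𝒟.arch.lie.toSubmodule)
    {φ : 𝒢.Adelic → ℂ} (hφs : IsArchSmooth 𝒟.ofArch φ) {M : ℕ} {r : ℕ → ℝ}
    (hann : ∀ x, ∑ j ∈ Finset.range (M + 1),
      (r j : ℂ) * ((fun ψ => ∑ i, iterLieDeriv 𝒟.ofArch [basisLie B i, basisLie B i] ψ)^[j] φ) x = 0)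
    (s : ℕ) :
    ∀ x, ∑ j ∈ Finset.range (M + s + 1), ((if s ≤ j then r (j - s) else 0 : ℝ) : ℂ) *
      ((fun ψ => ∑ i, iterLieDeriv 𝒟.ofArch [basisLie B i, basisLie B i] ψ)^[j] φ) x = 0 := by
  have hsm : isArchSmooth_lieDeriv (ι := 𝒟.ofArch) := isArchSmooth_lieDeriv_holds
  set L : (𝒢.Adelic → ℂ) → (𝒢.Adelic → ℂ) :=
    fun ψ => ∑ i, iterLieDeriv 𝒟.ofArch [basisLie B i, basisLie B i] ψ with hL
  -- `L` preserves smoothness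
  have hLs : ∀ ψ, IsArchSmooth 𝒟.ofArch ψ → IsArchSmooth 𝒟.ofArch (L ψ) := by
    intro ψ hψ
    rw [← mem_archSmooth_iff]
    exact (archSmooth 𝒟.ofArch).sum_mem fun i _ =>
      (mem_archSmooth_iff 𝒟.ofArch _).2 (hψ.iterLieDeriv_of_isArchSmooth_lieDeriv 𝒟.ofArch hsm _)
  have hLits : ∀ (j : ℕ) ψ, IsArchSmooth 𝒟.ofArch ψ → IsArchSmooth 𝒟.ofArch (L^[j] ψ) := by
    intro j
    induction j with
    | zero => intro ψ hψ; exact hψ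
    | succ j ih => intro ψ hψ; rw [Function.iterate_succ_apply']; exact hLs _ (ih ψ hψ)
  -- `L` is additive and homogeneous on smooth functions
  have hLadd : ∀ ψ₁ ψ₂, IsArchSmooth 𝒟.ofArch ψ₁ → IsArchSmooth 𝒟.ofArch ψ₂ →
      L (ψ₁ + ψ₂) = L ψ₁ + L ψ₂ := by
    intro ψ₁ ψ₂ h₁ h₂
    simp only [hL, ← Finset.sum_add_distrib]
    exact Finset.sum_congr rfl fun i _ =>
      iterLieDeriv_add_of_isArchSmooth_lieDeriv 𝒟.ofArch hsm h₁ h₂ _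
  have hLsmul : ∀ (c : ℂ) ψ, L (c • ψ) = c • L ψ := by
    intro c ψ
    simp only [hL, Finset.smul_sum]
    refine Finset.sum_congr rfl fun i _ => ?_
    simp only [iterLieDeriv_cons, iterLieDeriv_nil, lieDeriv_smul]
  have hL0 : L 0 = 0 := by
    have h := hLsmul 0 0
    rwa [zero_smul, zero_smul] at h
  -- hence `L^s` is linear on finite combinations of smooth functions and kills `0`
  have hL0s : ∀ s', L^[s'] (0 : 𝒢.Adelic → ℂ) = 0 := by
    intro s'
    induction s' with
    | zero => rfl
    | succ s' ih => rw [Function.iterate_succ_apply', ih, hL0]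
  have hsmulS : ∀ (c : ℂ) ψ, IsArchSmooth 𝒟.ofArch ψ → IsArchSmooth 𝒟.ofArch (c • ψ) :=
    fun c ψ hψ => (mem_archSmooth_iff 𝒟.ofArch _).1
      ((archSmooth 𝒟.ofArch).smul_mem c ((mem_archSmooth_iff 𝒟.ofArch _).2 hψ))
  have hmemsum : ∀ (m : ℕ) (c : ℕ → ℂ) (f : ℕ → 𝒢.Adelic → ℂ), (∀ j, IsArchSmooth 𝒟.ofArch (f j)) →
      IsArchSmooth 𝒟.ofArch (∑ j ∈ Finset.range m, c j • f j) := by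
    intro m c f hf
    rw [← mem_archSmooth_iff]
    exact (archSmooth 𝒟.ofArch).sum_mem fun j _ =>
      (archSmooth 𝒟.ofArch).smul_mem _ ((mem_archSmooth_iff 𝒟.ofArch _).2 (hf j))
  have hLlin : ∀ (m : ℕ) (c : ℕ → ℂ) (f : ℕ → 𝒢.Adelic → ℂ), (∀ j, IsArchSmooth 𝒟.ofArch (f j)) →
      L (∑ j ∈ Finset.range m, c j • f j) = ∑ j ∈ Finset.range m, c j • L (f j) := by
    intro m c f hf
    induction m with
    | zero => simpa using hL0
    | succ m ih =>
      rw [Finset.sum_range_succ, Finset.sum_range_succ, hLadd _ _ (hmemsum m c f hf)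
        (hsmulS (c m) _ (hf m)), ih, hLsmul]
  have hLslin : ∀ (s' m : ℕ) (c : ℕ → ℂ) (f : ℕ → 𝒢.Adelic → ℂ), (∀ j, IsArchSmooth 𝒟.ofArch (f j)) →
      L^[s'] (∑ j ∈ Finset.range m, c j • f j) = ∑ j ∈ Finset.range m, c j • L^[s'] (f j) := by
    intro s'
    induction s' with
    | zero => intro m c f _; rfl
    | succ s' ih =>
      intro m c f hf
      rw [Function.iterate_succ_apply', ih m c f hf, hLlin m c _ fun j => hLits s' _ (hf j)]
      simp only [Function.iterate_succ_apply']
  -- the annihilator as an identity of functions, and its shift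
  have hF : (∑ j ∈ Finset.range (M + 1), (r j : ℂ) • L^[j] φ) = 0 := by
    funext x
    have h := hann x
    simpa only [Finset.sum_apply, Pi.smul_apply, smul_eq_mul, Pi.zero_apply, hL] using h
  have hFs : (∑ j ∈ Finset.range (M + 1), (r j : ℂ) • L^[j] (L^[s] φ)) = 0 := by
    have e : (∑ j ∈ Finset.range (M + 1), (r j : ℂ) • L^[j] (L^[s] φ)) =
        L^[s] (∑ j ∈ Finset.range (M + 1), (r j : ℂ) • L^[j] φ) := by
      rw [hLslin s (M + 1) (fun j => (r j : ℂ)) (fun j => L^[j] φ) fun j => hLits j φ hφs]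
      refine Finset.sum_congr rfl fun j _ => ?_
      rw [← Function.iterate_add_apply, ← Function.iterate_add_apply, add_comm]
    rw [e, hF, hL0s]
  -- reindex
  intro x
  have e1 : M + s + 1 = s + (M + 1) := by ring
  rw [e1, Finset.sum_range_add]
  have h1 : ∑ j ∈ Finset.range s, ((if s ≤ j then r (j - s) else 0 : ℝ) : ℂ) * (L^[j] φ) x = 0 :=
    Finset.sum_eq_zero fun j hj => by
      rw [if_neg (not_le.2 (Finset.mem_range.1 hj))]; simp
  have h2 : ∑ j ∈ Finset.range (M + 1), ((if s ≤ s + j then r (s + j - s) else 0 : ℝ) : ℂ) *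
      (L^[s + j] φ) x = (∑ j ∈ Finset.range (M + 1), (r j : ℂ) • L^[j] (L^[s] φ)) x := by
    rw [Finset.sum_apply]
    refine Finset.sum_congr rfl fun j _ => ?_
    rw [if_pos (Nat.le_add_right s j), Nat.add_sub_cancel_left, Pi.smul_apply, smul_eq_mul,
      add_comm, Function.iterate_add_apply]
  rw [h1, zero_add, h2, hFs, Pi.zero_apply]

end Shift

/-! ### The reproducing identity in exponential coordinates -/

section Reproducing

/-- **Harish-Chandra's convolution identity in exponential coordinates, unconditionally.** Let
`𝒟` be a regular automorphy datum over a finite-dimensional coefficient algebra with `ℝ`-linear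
involution and `φ` an automorphic form. Then there is a basis `B` of `𝔤` (indexed by `Fin d`) such
that for every `ρ > 0` some smooth real `α` on `ℝ^d`, compactly supported inside the ball of
radius `ρ`, satisfies
`φ(g) = ∫ α(t) φ(g · ι(exp ∑ tᵢ Bᵢ)) dt` for every `g ∈ G(𝔸)`. Proof: by
`IsAutomorphicForm.exists_annihilator` and `annihilator_shift`, `∑ⱼ rⱼ L_B^j φ = 0` with `r_M = 1`
and `4M > d`; in the chart of `exists_chartFields` the functions `t ↦ ℓ(φ(g ι(exp ∑ tᵢBᵢ)))`
(`ℓ = Re, Im`) solve the transported equation near `0` (`smoothDiffOp_chartFun_eq_zero`), which is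
elliptic of order `2M > d/2` there (`isEllipticOn_pairPresentation`), and
`exists_kernel_of_isEllipticOn_of_lt` reproduces its solutions at `0`. Harish-Chandra 1966, §8,
Thm. 1; Borel 1972, Thm. 3.18; Borel 1997, Thm. 2.14 (`f = f ∗ α`).
[cite: HarishChandra1966, §8, Thm. 1] -/
theorem IsAutomorphicForm.exists_reproducing_chartExp [FiniteDimensional ℝ A] [StarModule ℝ A]
    (h𝒟 : 𝒟.IsRegular) {φ : 𝒢.Adelic → ℂ} (hφ : IsAutomorphicForm 𝒟 φ) :
    ∃ (d : ℕ) (B : Module.Basis (Fin d) ℝ 𝒟.arch.lie.toSubmodule), ∀ ρ : ℝ, 0 < ρ →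
      ∃ α : (Fin d → ℝ) → ℝ, ContDiff ℝ ∞ α ∧ HasCompactSupport α ∧ tsupport α ⊆ Metric.ball 0 ρ ∧
      ∀ g : 𝒢.Adelic, φ g = ∫ t, (α t : ℂ) * φ (g * 𝒟.ofArch (chartExp B t)) := by
  obtain ⟨d, B, M, r, hrM, hann⟩ := hφ.exists_annihilator h𝒟
  have hφs : IsArchSmooth 𝒟.ofArch φ := hφ.archSmooth
  refine ⟨d, B, fun ρ hρ => ?_⟩
  rcases Nat.eq_zero_or_pos d with hd | hd
  · -- `d = 0`: the chart is a point and `α = 1`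
    subst hd
    refine ⟨fun _ => 1, contDiff_const, ?_, ?_, fun g => ?_⟩
    · exact HasCompactSupport.of_support_subset_isCompact isCompact_univ (subset_univ _)
    · intro t _
      rw [Subsingleton.elim t 0]
      exact Metric.mem_ball_self hρ
    · have ht : ∀ t : Fin 0 → ℝ, chartExp B t = 1 := fun t => by
        rw [Subsingleton.elim t 0, chartExp_zero]
      simp only [ht, map_one, mul_one, Complex.ofReal_one, one_mul, integral_const]
      have hvol : (volume : Measure (Fin 0 → ℝ)).real Set.univ = 1 := by
        rw [Measure.real, MeasureTheory.volume_pi, Measure.pi_univ]; simp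
      rw [hvol, one_smul]
  -- `d > 0`: raise the order of the annihilator so that `4M' > d`
  haveI : Nonempty (Fin d) := ⟨⟨0, hd⟩⟩
  set M' : ℕ := M + d with hM'
  set r' : ℕ → ℝ := fun j => if d ≤ j then r (j - d) else 0 with hr'
  have hrM' : r' M' = 1 := by
    simp only [hr', hM', if_pos (Nat.le_add_left d M), Nat.add_sub_cancel]; exact hrM
  have hann' := annihilator_shift B hφs hann d
  have hreg := h𝒟.mem_lie_of_expGL_mem
  have hs : isArchSmooth_lieDeriv (ι := 𝒟.ofArch) := isArchSmooth_lieDeriv_holds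
  -- chart fields and the word form of the (raised) annihilator
  obtain ⟨Ξ, Ω₀, hΞs, hΞ0, hΩ₀, h0Ω₀, hΞ⟩ := exists_chartFields (ι := 𝒟.ofArch) hreg B
  have hannw : ∀ x, ∑ w ∈ pairWords d M', (pairCoeff d M' r' w : ℂ) *
      iterLieDeriv 𝒟.ofArch (w.map (basisLie B)) φ x = 0 := fun x => by
    rw [sum_pairWords_iterLieDeriv_eq 𝒟.ofArch (basisLie B) hφs M' r' x]
    have h := hann' x
    rw [← hM'] at h
    exact h
  -- the elliptic set and the domain
  set Ω₁ : Set (Fin d → ℝ) := {x | (fieldMatrix Ξ x).det ≠ 0} with hΩ₁_def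
  have hΩ₁ : IsOpen Ω₁ :=
    isOpen_ne.preimage ((continuous_fieldMatrix fun j => (hΞs j).continuous).matrix_det)
  have h0Ω₁ : (0 : Fin d → ℝ) ∈ Ω₁ := by
    change (fieldMatrix Ξ 0).det ≠ 0
    rw [fieldMatrix_eq_one_of hΞ0, Matrix.det_one]
    exact one_ne_zero
  let Ω : TopologicalSpace.Opens (Fin d → ℝ) :=
    ⟨(Ω₀ ∩ Ω₁) ∩ Metric.ball 0 ρ, (hΩ₀.inter hΩ₁).inter Metric.isOpen_ball⟩
  have h0Ω : (0 : Fin d → ℝ) ∈ (Ω : Set (Fin d → ℝ)) := ⟨⟨h0Ω₀, h0Ω₁⟩, Metric.mem_ball_self hρ⟩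
  have hell : IsEllipticOn Ξ (pairWords d M') (fun w _ => pairCoeff d M' r' w) (2 * M')
      (Ω : Set (Fin d → ℝ)) :=
    isEllipticOn_pairPresentation Ξ M' r' hrM' fun x hx => hx.1.2
  have hk : (Module.finrank ℝ (Fin d → ℝ) : ℝ) < 2 * (2 * M' : ℕ) := by
    rw [Module.finrank_fin_fun]
    have h1 : (1 : ℝ) ≤ d := by exact_mod_cast hd
    push_cast
    rw [hM']
    push_cast
    linarith
  -- the reproducing kernel (unconditional)
  obtain ⟨U, h0U, hUΩ, α, hαs, hαc, hαU, hrep⟩ := exists_kernel_of_isEllipticOn_of_lt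
    (volume : Measure (Fin d → ℝ)) hΞs (fun w _ => contDiff_const) hell hk h0Ω
  have hUΩ' : (U : Set (Fin d → ℝ)) ⊆ (Ω : Set (Fin d → ℝ)) := hUΩ
  have hUΩ₀ : (U : Set (Fin d → ℝ)) ⊆ Ω₀ := fun x hx => (hUΩ' hx).1.1
  have hαρ : tsupport α ⊆ Metric.ball 0 ρ := hαU.trans fun x hx => (hUΩ' hx).2
  refine ⟨α, hαs, hαc, hαρ, fun g' => ?_⟩
  -- the reproducing identity for every translate
  have hℓ : ∀ ℓ : ℂ →L[ℝ] ℝ, ℓ (φ g') = ∫ t, α t * ℓ (chartFun 𝒟.ofArch B φ g' t) := by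
    intro ℓ
    have hv := hrep (fun t => ℓ (chartFun 𝒟.ofArch B φ g' t)) (contDiff_comp_chartFun B hφs ℓ g')
      (fun x hx => smoothDiffOp_chartFun_eq_zero hΩ₀ hΞ hs hφs hannw ℓ g' x (hUΩ₀ hx))
    rwa [chartFun_apply, chartExp_zero, map_one, mul_one] at hv
  have hαc' : HasCompactSupport fun t => ((α t : ℝ) : ℂ) := hαc.comp_left Complex.ofReal_zero
  have hint : Integrable (fun t => (α t : ℂ) * chartFun 𝒟.ofArch B φ g' t) :=
    ((Complex.continuous_ofReal.comp hαs.continuous).mul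
      (contDiff_chartFun B hφs g').continuous).integrable_of_hasCompactSupport hαc'.mul_right
  have hgoal : φ g' = ∫ t, (α t : ℂ) * chartFun 𝒟.ofArch B φ g' t := by
    apply Complex.ext
    · rw [← Complex.reCLM_apply (φ g'), hℓ Complex.reCLM, ← RCLike.re_to_complex, ← integral_re hint]
      refine integral_congr_ae (Filter.Eventually.of_forall fun t => ?_)
      simp
    · rw [← Complex.imCLM_apply (φ g'), hℓ Complex.imCLM, ← RCLike.im_to_complex, ← integral_im hint]
      refine integral_congr_ae (Filter.Eventually.of_forall fun t => ?_)
      simp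
  simpa only [chartFun_apply] using hgoal

end Reproducing

end Literature.NumberTheory.Automorphic
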